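import Summits.QuantumFields.YangMills.Theorems.FluctuationComparisonRegPrIntLS2BetaLiftLadderFaceRow
import Summits.QuantumFields.YangMills.Theorems.FluctuationComparisonRegPrIntLS2BetaDiscrepancyIntraBlock
import HarnessLib

/-!
# S2β · Q11g — THE PER-`B` ONE-PROFILE ROW AT ONE `Params`: px20's lift engine with the discrepancy letter DISCHARGED BY CASES
# (intra-block bonds: the ladder Q11f; face-crossing bonds: the face letter) — architect RULING (3) 19:37:59Z

Cell `ym3-torus` (rung R3 = continuum `SU(2)` YM₃ on T³ at fixed lattice data — NOT d = 4, NOT infinite volume, NOT a mass gap, NOT Clay).  Width seat `ym3-torus-px5` (gen 23);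
crux `stmt-QuantumFields-20520`, LINE g18-1 S2β; LIFT-LADDER″ ONE-PROFILE (architect 19:24:49Z (ii), 19:37:59Z (1)–(3)): per block pair `B`, every bond `b` of `READ′_{t+1}(B)` has main part the
relative lift `R_b` (px20 g24 ✓p832421 `…LiftLadderFaceRow`: `‖log R_b‖ ≤ 11∕10·L⁻¹·(parent read max)`) and discrepancy `ε_b = R_b⁻¹·η_b`; the engine ✓`sq_pi_norm_trunc_le_of_lift_add_disc_offComb`
turns a discrepancy letter `‖logVec (su2Quat (R_b⁻¹·η_b))‖ ≤ s` on the `pS`-bonds OFF the tree comb into `‖𝟙_{pS}·logVec η_j‖² ≤ (1+κ)(11∕10·L⁻¹)²·‖𝟙_{pT}·logVec η_{j+1}‖² + (1+κ⁻¹)·s²`.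
THIS FILE discharges that letter BY CASES — an INTRA-BLOCK bond (`blockOf (b.src + b.dir) = blockOf b.src`) pays the LADDER of Q11f ✓`norm_logVec_disc_le_of_intraBlock_stage_crude`
(`≤ (π∕2)·((d−1)·((L−1)∕2))·ρ̃`, `ρ̃` = the relative-plaquette sup of `(W_t, A_W·A_U⁻¹·U_t)` on the blocks met by `pS` — px12 g26 (d)), a FACE-CROSSING bond pays the face letter `sF` (RULING (i),
px20∕px17 — a hypothesis here) — so the per-`B` row reads **`s := sF + (π∕2)·((d−1)·((L−1)∕2))·ρ̃`**, and its truncated discrepancy Pi-norm (px20's letter-free source `D′`) is `≤ s` (§2).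
`--kind proof --supports stmt-QuantumFields-20520 --as helper`, count-neutral, DEFINITION-FREE (0 `def`, 0 `instance`, 0 `notation`, 0 `sorry`, default heartbeats); `SU(2)`, generic `P : Params`
(standing range), ANY `av`, abstract `wt lift g g₀` under px20's engine hypotheses VERBATIM.

WHAT IS PROVED (sorry-free).
* §1 ★`norm_logVec_disc_le_perBlock` — the POINTWISE discrepancy letter on every `pS`-bond (intra-block by the ladder, face-crossing by `sF`).
* §2 ★`pi_norm_disc_trunc_le_perBlock` — the truncated discrepancy Pi-norm `‖𝟙_{pS ∧ ¬comb}·logVec (R⁻¹η)‖ ≤ s` (px20's `D′` source per `B`, before squaring).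
* §3 ★★★`sq_pi_norm_trunc_le_perBlock` — ✓`sq_pi_norm_trunc_le_of_lift_add_disc_offComb` with `hdisc` DISCHARGED: the per-`B` one-profile row with `s = sF + (π∕2)·((d−1)·((L−1)∕2))·ρ̃`.

HONEST SCOPE.  Assembly over landed lemmas; nothing of Bałaban's analysis is asserted or proved; the face letter `sF` (RULING (i)), `ρ̃`'s bound (px12 (d)), the arc profile `σ ≤ 1∕4`, the tower
re-indexing (`READ′` ↔ `pS`∕`pT`, px20's ⧗`…LiftLadderOneProfileTower`) and the budgets are NOT here; COMB-ROW′∕NC-ROW′∕(TOP-LAD′)∕(SCT′)∕(ST′)∕(ST), LOC's discharge, «MULT♭-ax»∕«CRIT-ax»,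
(D-stage), h3, GAP♯∘ (`stub_uniformFibreGapOrbit`, registry 3732b7df UNTOUCHED, 0∕5), S2β, the five registered stubs, 20520, 19936, 19200, `YM3TorusSU2` NOT proved; no summit statement is
proved by a helper; rung R3 — NOT d = 4, NOT infinite volume, NOT a mass gap, NOT Clay; the Yang–Mills mass gap is NOT proved.

References: T. Bałaban, CMP **102** (1985) 277–309 [Balaban1985RegularSpaces] ((1.19) p.79, (1.29) p.81); CMP **98** (1985) 17–51 [Balaban1985Averaging] ((58) p.27); CMP **122** (1989)
355–392 [Balaban1989LargeFieldII] (p.382).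
-/

set_option autoImplicit false

namespace Summit.QuantumFields.YangMills.Theorems.FluctuationComparisonRegPrIntLS2BetaLiftLadderPerBlockRow

open scoped Real
open Literature.MathematicalPhysics.QuantumLattice (su2Quat)
open Literature.MathematicalPhysics.QuantumFieldTheory.Balaban1983to89
open Literature.MathematicalPhysics.QuantumFieldTheory.Balaban1983to89.T4Continuum
open Literature.MathematicalPhysics.QuantumFieldTheory.Balaban1983to89.BlockAveraging
open B10Eq27TorusAxialLog (rel axialT)
open T4CubeChartGnomonic (SU2)
open T4HaarSU2ExpChart (expPoint)
open T4ExpWindowSmallField (logVec)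
open Summit.QuantumFields.YangMills.Theorems.FluctuationComparisonRegPrIntLS2BetaLiftLadderFaceRow (sq_pi_norm_trunc_le_of_lift_add_disc_offComb)
open Summit.QuantumFields.YangMills.Theorems.FluctuationComparisonRegPrIntLS2BetaDiscrepancyIntraBlock (norm_logVec_disc_le_of_intraBlock_stage_crude)

variable {P : Params}

/-! ## §1 The pointwise discrepancy letter by cases -/

/-- ★ **THE DISCREPANCY LETTER ON EVERY `pS`-BOND, BY CASES**: intra-block bonds pay the ladder `(π∕2)·((d−1)·((L−1)∕2))·ρ̃` (Q11f), face-crossing bonds pay the face source `sF`; hence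
`‖logVec (su2Quat (R_b⁻¹·η_b))‖ ≤ sF + (π∕2)·((d−1)·((L−1)∕2))·ρ̃` for every `pS`-bond. [cite: Balaban1985RegularSpaces, (1.19) p.79; Balaban1989LargeFieldII, p.382] -/
theorem norm_logVec_disc_le_perBlock (av : ∀ i, Averaging P i SU2) {j : ℕ} (hj : j + 1 ≤ P.m + P.K)
    (lift : (i : ℕ) → GaugeField P (i + 1) SU2 → GaugeField P i SU2) (g g₀ : (i : ℕ) → Site P i → SU2) (U U₁ : GaugeField P 0 SU2)
    (hT4 : ∀ x, axialT (GaugeField.gaugeAct (g j) (Averaging.iter av j U)) (emb (blockOf x)) x =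
      axialT (lift j (GaugeField.gaugeAct (g (j + 1)) (Averaging.iter av (j + 1) U))) (emb (blockOf x)) x)
    (hT4' : ∀ x, axialT (GaugeField.gaugeAct (g₀ j) (Averaging.iter av j U₁)) (emb (blockOf x)) x =
      axialT (lift j (GaugeField.gaugeAct (g₀ (j + 1)) (Averaging.iter av (j + 1) U₁))) (emb (blockOf x)) x)
    (pS : PBond P j → Prop)
    {ρt : ℝ} (hρ0 : 0 ≤ ρt)
    (hρ : ∀ q : Plaq P j, (∃ b : PBond P j, pS b ∧ blockOf q.src = blockOf b.src) →
      dist1 ((GaugeField.plaqHol (fun b => lift j (GaugeField.gaugeAct (g (j + 1)) (Averaging.iter av (j + 1) U)) b *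
            (lift j (GaugeField.gaugeAct (g₀ (j + 1)) (Averaging.iter av (j + 1) U₁)) b)⁻¹ *
          GaugeField.gaugeAct (g₀ j) (Averaging.iter av j U₁) b : GaugeField P j SU2) q)⁻¹ *
        GaugeField.plaqHol (GaugeField.gaugeAct (g j) (Averaging.iter av j U)) q) ≤ ρt)
    {sF : ℝ} (hsF0 : 0 ≤ sF)
    (hface : ∀ b : PBond P j, pS b → blockOf (b.src.shift b.dir) ≠ blockOf b.src →
      ‖logVec (su2Quat ((lift j (GaugeField.gaugeAct (g (j + 1)) (Averaging.iter av (j + 1) U)) b *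
          (lift j (GaugeField.gaugeAct (g₀ (j + 1)) (Averaging.iter av (j + 1) U₁)) b)⁻¹)⁻¹ *
        (GaugeField.gaugeAct (g j) (Averaging.iter av j U) b * (GaugeField.gaugeAct (g₀ j) (Averaging.iter av j U₁) b)⁻¹)))‖ ≤ sF)
    (b : PBond P j) (hb : pS b) :
    ‖logVec (su2Quat ((lift j (GaugeField.gaugeAct (g (j + 1)) (Averaging.iter av (j + 1) U)) b *
          (lift j (GaugeField.gaugeAct (g₀ (j + 1)) (Averaging.iter av (j + 1) U₁)) b)⁻¹)⁻¹ *
        (GaugeField.gaugeAct (g j) (Averaging.iter av j U) b * (GaugeField.gaugeAct (g₀ j) (Averaging.iter av j U₁) b)⁻¹)))‖ ≤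
      sF + π / 2 * ((((P.d - 1) * ((P.L - 1) / 2) : ℕ) : ℝ) * ρt) := by
  have hintra0 : 0 ≤ π / 2 * ((((P.d - 1) * ((P.L - 1) / 2) : ℕ) : ℝ) * ρt) := by positivity
  by_cases hin : blockOf (b.src.shift b.dir) = blockOf b.src
  · -- intra-block: the ladder of Q11f at the block of `b.src`
    obtain ⟨y, e⟩ := b
    have hρ' : ∀ q : Plaq P j, blockOf q.src = blockOf y →
        dist1 ((GaugeField.plaqHol (fun b => lift j (GaugeField.gaugeAct (g (j + 1)) (Averaging.iter av (j + 1) U)) b *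
              (lift j (GaugeField.gaugeAct (g₀ (j + 1)) (Averaging.iter av (j + 1) U₁)) b)⁻¹ *
            GaugeField.gaugeAct (g₀ j) (Averaging.iter av j U₁) b : GaugeField P j SU2) q)⁻¹ *
          GaugeField.plaqHol (GaugeField.gaugeAct (g j) (Averaging.iter av j U)) q) ≤ ρt :=
      fun q hq => hρ q ⟨⟨y, e⟩, hb, hq⟩
    have h := norm_logVec_disc_le_of_intraBlock_stage_crude av hj lift g g₀ U U₁ hT4 hT4' (blockOf y) hρ0 hρ' y e rfl hin
    have hed : (((e.val * ((P.L - 1) / 2) : ℕ) : ℝ) * ρt) ≤ (((P.d - 1) * ((P.L - 1) / 2) : ℕ) : ℝ) * ρt := by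
      refine mul_le_mul_of_nonneg_right ?_ hρ0
      have he : e.val ≤ P.d - 1 := by have := e.isLt; omega
      exact_mod_cast Nat.mul_le_mul_right _ he
    have hπ : 0 ≤ π / 2 := by positivity
    linarith [mul_le_mul_of_nonneg_left hed hπ]
  · -- face-crossing: the face letter
    have h := hface b hb hin
    linarith

/-! ## §2 The truncated discrepancy Pi-norm (px20's letter-free source `D′`, before squaring) -/

/-- ★ **THE TRUNCATED DISCREPANCY Pi-NORM PER `B`**: `‖(b ↦ 𝟙[pS b ∧ ¬ treecomb b]·logVec (su2Quat (R_b⁻¹·η_b)))‖ ≤ sF + (π∕2)·((d−1)·((L−1)∕2))·ρ̃`.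
[cite: Balaban1985RegularSpaces, (1.19) p.79; Balaban1989LargeFieldII, p.382] -/
theorem pi_norm_disc_trunc_le_perBlock (av : ∀ i, Averaging P i SU2) {j : ℕ} (hj : j + 1 ≤ P.m + P.K)
    (lift : (i : ℕ) → GaugeField P (i + 1) SU2 → GaugeField P i SU2) (g g₀ : (i : ℕ) → Site P i → SU2) (U U₁ : GaugeField P 0 SU2)
    (hT4 : ∀ x, axialT (GaugeField.gaugeAct (g j) (Averaging.iter av j U)) (emb (blockOf x)) x =
      axialT (lift j (GaugeField.gaugeAct (g (j + 1)) (Averaging.iter av (j + 1) U))) (emb (blockOf x)) x)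
    (hT4' : ∀ x, axialT (GaugeField.gaugeAct (g₀ j) (Averaging.iter av j U₁)) (emb (blockOf x)) x =
      axialT (lift j (GaugeField.gaugeAct (g₀ (j + 1)) (Averaging.iter av (j + 1) U₁))) (emb (blockOf x)) x)
    (pS : PBond P j → Prop) [DecidablePred pS]
    {ρt : ℝ} (hρ0 : 0 ≤ ρt)
    (hρ : ∀ q : Plaq P j, (∃ b : PBond P j, pS b ∧ blockOf q.src = blockOf b.src) →
      dist1 ((GaugeField.plaqHol (fun b => lift j (GaugeField.gaugeAct (g (j + 1)) (Averaging.iter av (j + 1) U)) b *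
            (lift j (GaugeField.gaugeAct (g₀ (j + 1)) (Averaging.iter av (j + 1) U₁)) b)⁻¹ *
          GaugeField.gaugeAct (g₀ j) (Averaging.iter av j U₁) b : GaugeField P j SU2) q)⁻¹ *
        GaugeField.plaqHol (GaugeField.gaugeAct (g j) (Averaging.iter av j U)) q) ≤ ρt)
    {sF : ℝ} (hsF0 : 0 ≤ sF)
    (hface : ∀ b : PBond P j, pS b → blockOf (b.src.shift b.dir) ≠ blockOf b.src →
      ‖logVec (su2Quat ((lift j (GaugeField.gaugeAct (g (j + 1)) (Averaging.iter av (j + 1) U)) b *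
          (lift j (GaugeField.gaugeAct (g₀ (j + 1)) (Averaging.iter av (j + 1) U₁)) b)⁻¹)⁻¹ *
        (GaugeField.gaugeAct (g j) (Averaging.iter av j U) b * (GaugeField.gaugeAct (g₀ j) (Averaging.iter av j U₁) b)⁻¹)))‖ ≤ sF) :
    ‖(fun b : PBond P j =>
        if pS b ∧ ¬ (blockOf (b.src.shift b.dir) = blockOf b.src ∧ ∀ ν, ν < b.dir → rel (emb (blockOf b.src)) b.src ν = 0) then
          logVec (su2Quat ((lift j (GaugeField.gaugeAct (g (j + 1)) (Averaging.iter av (j + 1) U)) b *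
              (lift j (GaugeField.gaugeAct (g₀ (j + 1)) (Averaging.iter av (j + 1) U₁)) b)⁻¹)⁻¹ *
            (GaugeField.gaugeAct (g j) (Averaging.iter av j U) b * (GaugeField.gaugeAct (g₀ j) (Averaging.iter av j U₁) b)⁻¹)))
        else 0)‖ ≤
      sF + π / 2 * ((((P.d - 1) * ((P.L - 1) / 2) : ℕ) : ℝ) * ρt) := by
  classical
  have hs0 : 0 ≤ sF + π / 2 * ((((P.d - 1) * ((P.L - 1) / 2) : ℕ) : ℝ) * ρt) := by positivity
  refine (pi_norm_le_iff_of_nonneg hs0).mpr (fun b => ?_)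
  by_cases hb : pS b ∧ ¬ (blockOf (b.src.shift b.dir) = blockOf b.src ∧ ∀ ν, ν < b.dir → rel (emb (blockOf b.src)) b.src ν = 0)
  · rw [if_pos hb]
    exact norm_logVec_disc_le_perBlock av hj lift g g₀ U U₁ hT4 hT4' pS hρ0 hρ hsF0 hface b hb.1
  · rw [if_neg hb, norm_zero]
    exact hs0

/-! ## §3 The per-`B` one-profile row -/

/-- ★★★ **THE PER-`B` ONE-PROFILE ROW AT ONE `Params`** (px20's ✓`sq_pi_norm_trunc_le_of_lift_add_disc_offComb` with its discrepancy letter DISCHARGED by §1):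
`‖𝟙_{pS}·logVec η_j‖² ≤ (1+κ)·(11∕10·L⁻¹)²·‖𝟙_{pT}·logVec η_{j+1}‖² + (1+κ⁻¹)·(sF + (π∕2)·((d−1)·((L−1)∕2))·ρ̃)²` — comb bonds free by (T4), intra-block bonds by the ladder, face-crossing bonds by `sF`.
[cite: Balaban1985RegularSpaces, (1.19) p.79, (1.29) p.81; Balaban1985Averaging, (58) p.27; Balaban1989LargeFieldII, p.382] -/
theorem sq_pi_norm_trunc_le_perBlock (av : ∀ i, Averaging P i SU2) {j : ℕ} (hj : j + 1 ≤ P.m + P.K)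
    (wt : (i : ℕ) → PBond P i → PBond P (i + 1) → ℝ) (lift : (i : ℕ) → GaugeField P (i + 1) SU2 → GaugeField P i SU2)
    (g g₀ : (i : ℕ) → Site P i → SU2) (U U₁ U₀ : GaugeField P 0 SU2)
    (hwt : ∀ b e, wt j b e = if e.dir = b.dir ∧ (b.src b.dir - emb e.src b.dir).val < P.L then
      ∏ ν ∈ Finset.univ.erase b.dir, max 0 (1 - ((rel (emb e.src) b.src ν).natAbs : ℝ) / P.L) else 0)
    (hlift : ∀ (X : GaugeField P (j + 1) SU2) (b : PBond P j), lift j X b = expPoint (∑ e, wt j b e • ((P.L : ℝ)⁻¹ • logVec (su2Quat (X e)))))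
    (hT3 : ∀ X : GaugeField P 0 SU2, Averaging.iter av j (GaugeField.gaugeAct (g 0) X) = GaugeField.gaugeAct (g j) (Averaging.iter av j X))
    (hT3s : ∀ X : GaugeField P 0 SU2, Averaging.iter av (j + 1) (GaugeField.gaugeAct (g 0) X) = GaugeField.gaugeAct (g (j + 1)) (Averaging.iter av (j + 1) X))
    (hT3' : ∀ X : GaugeField P 0 SU2, Averaging.iter av j (GaugeField.gaugeAct (g₀ 0) X) = GaugeField.gaugeAct (g₀ j) (Averaging.iter av j X))
    (hT3s' : ∀ X : GaugeField P 0 SU2, Averaging.iter av (j + 1) (GaugeField.gaugeAct (g₀ 0) X) = GaugeField.gaugeAct (g₀ (j + 1)) (Averaging.iter av (j + 1) X))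
    (hU₀ : U₀ = GaugeField.gaugeAct (fun x => (g 0 x)⁻¹ * g₀ 0 x) U₁)
    (hT4 : ∀ x, axialT (GaugeField.gaugeAct (g j) (Averaging.iter av j U)) (emb (blockOf x)) x =
      axialT (lift j (GaugeField.gaugeAct (g (j + 1)) (Averaging.iter av (j + 1) U))) (emb (blockOf x)) x)
    (hT4' : ∀ x, axialT (GaugeField.gaugeAct (g₀ j) (Averaging.iter av j U₁)) (emb (blockOf x)) x =
      axialT (lift j (GaugeField.gaugeAct (g₀ (j + 1)) (Averaging.iter av (j + 1) U₁))) (emb (blockOf x)) x)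
    (hL2 : 2 ≤ P.L) {σ : ℝ} (hσ4 : σ ≤ 1 / 4)
    (pS : PBond P j → Prop) [DecidablePred pS] (pT : PBond P (j + 1) → Prop) [DecidablePred pT]
    (hnest : ∀ b, pS b → ∀ e, wt j b e ≠ 0 → pT e)
    (hσ : ∀ e, pT e → ‖logVec (su2Quat (GaugeField.gaugeAct (g (j + 1)) (Averaging.iter av (j + 1) U) e))‖ ≤ σ)
    (hσ' : ∀ e, pT e → ‖logVec (su2Quat (GaugeField.gaugeAct (g₀ (j + 1)) (Averaging.iter av (j + 1) U₁) e))‖ ≤ σ)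
    {ρt : ℝ} (hρ0 : 0 ≤ ρt)
    (hρ : ∀ q : Plaq P j, (∃ b : PBond P j, pS b ∧ blockOf q.src = blockOf b.src) →
      dist1 ((GaugeField.plaqHol (fun b => lift j (GaugeField.gaugeAct (g (j + 1)) (Averaging.iter av (j + 1) U)) b *
            (lift j (GaugeField.gaugeAct (g₀ (j + 1)) (Averaging.iter av (j + 1) U₁)) b)⁻¹ *
          GaugeField.gaugeAct (g₀ j) (Averaging.iter av j U₁) b : GaugeField P j SU2) q)⁻¹ *
        GaugeField.plaqHol (GaugeField.gaugeAct (g j) (Averaging.iter av j U)) q) ≤ ρt)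
    {sF : ℝ} (hsF0 : 0 ≤ sF)
    (hface : ∀ b : PBond P j, pS b → blockOf (b.src.shift b.dir) ≠ blockOf b.src →
      ‖logVec (su2Quat ((lift j (GaugeField.gaugeAct (g (j + 1)) (Averaging.iter av (j + 1) U)) b *
          (lift j (GaugeField.gaugeAct (g₀ (j + 1)) (Averaging.iter av (j + 1) U₁)) b)⁻¹)⁻¹ *
        (GaugeField.gaugeAct (g j) (Averaging.iter av j U) b * (GaugeField.gaugeAct (g₀ j) (Averaging.iter av j U₁) b)⁻¹)))‖ ≤ sF)
    {κ : ℝ} (hκ : 0 < κ) :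
    ‖(fun b : PBond P j => if pS b then logVec (su2Quat (Averaging.iter av j U b * (Averaging.iter av j U₀ b)⁻¹)) else 0)‖ ^ 2 ≤
      (1 + κ) * (11 / 10 * (P.L : ℝ)⁻¹) ^ 2 *
        ‖(fun e : PBond P (j + 1) => if pT e then logVec (su2Quat (Averaging.iter av (j + 1) U e * (Averaging.iter av (j + 1) U₀ e)⁻¹)) else 0)‖ ^ 2 +
      (1 + κ⁻¹) * (sF + π / 2 * ((((P.d - 1) * ((P.L - 1) / 2) : ℕ) : ℝ) * ρt)) ^ 2 := by
  have hs0 : 0 ≤ sF + π / 2 * ((((P.d - 1) * ((P.L - 1) / 2) : ℕ) : ℝ) * ρt) := by positivity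
  exact sq_pi_norm_trunc_le_of_lift_add_disc_offComb av hj wt lift g g₀ U U₁ U₀ hwt hlift hT3 hT3s hT3' hT3s' hU₀ hT4 hT4' hL2 hσ4 pS pT hnest hσ hσ' hs0
    (fun b hb _ => norm_logVec_disc_le_perBlock av hj lift g g₀ U U₁ hT4 hT4' pS hρ0 hρ hsF0 hface b hb) hκ

end Summit.QuantumFields.YangMills.Theorems.FluctuationComparisonRegPrIntLS2BetaLiftLadderPerBlockRow
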